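import Mathlib
import HarnessLib

/-!
# The PERIODIC massive-mode rung, brick PM-IIa(i): the TWO-VARIABLE HADAMARD LEMMA `G = uᵐ·sⁿ·Φ`, `Φ` JOINTLY CONTINUOUS (Lagrange form, no integrals)
# (free-hands support of ⟨stmt-QuantumFields-24196⟩ `SwapVirialDeficit.ToronSoftnessSharp`; PM-IIa(i) of LEAD ym-line-sfw-p2 g96's PM design memo
# `sfw-p2-g96-memo-24196-PM-design.md` §1(c)/§3, consumed by PM-IIb — the structure theorem of the periodic two-scale chart with `m = 4`, `n = 2`)

GENERIC real analysis over a parameter space `X` (any topological space).  INPUT: a grid of functions `D i j : ℝ × ℝ × X → ℝ` (`i ≤ m`, `j ≤ n`; think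
`D i j = ∂ᵤⁱ∂ₛʲG`, `G = D 0 0`) with the one-variable derivative relations along the two coordinate lines (`hu`: `∂ᵤ D i j = D (i+1) j`; `hs`: `∂ₛ D i j = D i (j+1)`),
every `D i j` jointly continuous, and the vanishing data (a) `D 0 j (u, 0, ξ) = 0` (`j < n`), (b) `D i 0 (0, s, ξ) = 0` (`i < m`).
OUTPUT ★★★ `exists_continuous_twoVarHadamard`: a jointly continuous `Φ` with `G(u,s,ξ) = uᵐ sⁿ Φ(u,s,ξ)` everywhere and `Φ(0,0,ξ) = D m n (0,0,ξ)/(m!·n!)`.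
Method: one-variable Taylor–LAGRANGE along lines (✓`taylor_mean_remainder_lagrange_iteratedDeriv`) — `Φ` is represented on each stratum as `D · ·` evaluated at an
intermediate point `(θ₂u, θ₁s, ξ)`, `θ ∈ [0,1]`, and joint continuity follows from that of `D` (no parametric integrals, no Schwarz/Clairaut: the grid carries both relations).
Also: `contDiff_of_derivChain` / `iteratedDeriv_eq_of_derivChain` (a derivative chain gives `ContDiff` and identifies `iteratedDeriv`), ★ `exists_lagrange_of_jet_vanish`
(one-variable Hadamard–Lagrange: `f(x) = f⁽ᵏ⁺¹⁾(θx)·x^{k+1}/(k+1)!`).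
HONEST LABEL: calculus; PM-IIb (instantiation to the ring deficit) is LEAD g96's and NOT proved here; ⟨24196⟩/⟨24497⟩ OPEN; own crux ⟨22884⟩ OPEN (blocked-on ⟨19935⟩);
the Yang–Mills mass gap is NOT proved; no summit is proved by a line.  Width seat ym-line-sfw-p2-w3 g64 (cell ym-idea-1, free hands), `--supports stmt-QuantumFields-24196`.
THEOREMS ONLY (0 `def`, 0 `sorry`), standard axioms.  References: [folklore] (Hadamard's lemma / Taylor with Lagrange remainder); [cite: Luscher1983, §2] for the use.
-/

set_option autoImplicit false

noncomputable section

open Set Filter Topology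
open scoped Nat

namespace Summit.QuantumFields.YangMills.Theorems.SwapVirialDeficit.BlowUp

/-! ## §1 One variable: derivative chains and the Hadamard–Lagrange representation -/

/-- A derivative chain `F 0 → F 1 → ⋯ → F n` identifies the iterated derivatives: `iteratedDeriv j (F 0) = F j` (`j ≤ n`). [folklore] -/
theorem iteratedDeriv_eq_of_derivChain {F : ℕ → ℝ → ℝ} {n : ℕ} (hd : ∀ j < n, ∀ s, HasDerivAt (F j) (F (j + 1) s) s) :
    ∀ j ≤ n, iteratedDeriv j (F 0) = F j := by
  intro j hj
  induction j with
  | zero => exact iteratedDeriv_zero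
  | succ j ih =>
    rw [iteratedDeriv_succ, ih (by omega)]
    exact funext fun s => (hd j (by omega) s).deriv

/-- A derivative chain with continuous last member gives `ContDiff ℝ n (F 0)`. [folklore] -/
theorem contDiff_of_derivChain {F : ℕ → ℝ → ℝ} {n : ℕ} (hd : ∀ j < n, ∀ s, HasDerivAt (F j) (F (j + 1) s) s) (hc : Continuous (F n)) :
    ContDiff ℝ n (F 0) := by
  have hid := iteratedDeriv_eq_of_derivChain hd
  refine contDiff_iff_iteratedDeriv.2 ⟨fun j hj => ?_, fun j hj => ?_⟩
  · have hj' : j ≤ n := by exact_mod_cast hj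
    rw [hid j hj']
    rcases hj'.lt_or_eq with hlt | heq
    · exact continuous_iff_continuousAt.2 fun s => (hd j hlt s).continuousAt
    · rw [heq]; exact hc
  · have hj' : j < n := by exact_mod_cast hj
    rw [hid j hj'.le]
    exact fun s => (hd j hj' s).differentiableAt

/-- ★ One-variable Hadamard–Lagrange: `f ∈ C^{k+1}` with `f⁽ⁱ⁾(0) = 0` for `i ≤ k` ⟹ `f(x) = f⁽ᵏ⁺¹⁾(θx)·x^{k+1}/(k+1)!` for some `θ ∈ (0,1)` (`x ≠ 0`). [folklore] -/
theorem exists_lagrange_of_jet_vanish {f : ℝ → ℝ} {k : ℕ} (hf : ContDiff ℝ (k + 1) f) (h0 : ∀ i ≤ k, iteratedDeriv i f 0 = 0) {x : ℝ} (hx : x ≠ 0) :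
    ∃ θ ∈ Ioo (0 : ℝ) 1, f x = iteratedDeriv (k + 1) f (θ * x) * x ^ (k + 1) / (k + 1)! := by
  obtain ⟨x', hx', h⟩ := taylor_mean_remainder_lagrange_iteratedDeriv hx.symm (hf.contDiffOn (s := uIcc 0 x))
  have hpoly : taylorWithinEval f k (uIcc 0 x) 0 x = 0 := by
    rw [taylor_within_apply]
    refine Finset.sum_eq_zero fun i hi => ?_
    have hU : UniqueDiffOn ℝ (uIcc 0 x) := uniqueDiffOn_Icc (inf_lt_sup.2 hx.symm)
    rw [iteratedDerivWithin_eq_iteratedDeriv hU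
      (hf.contDiffAt.of_le (by exact_mod_cast (Finset.mem_range_succ_iff.1 hi).trans (Nat.le_succ k))) left_mem_uIcc,
      h0 i (Finset.mem_range_succ_iff.1 hi), smul_zero]
  rw [hpoly, sub_zero, sub_zero] at h
  refine ⟨x' / x, ?_, ?_⟩
  · rcases lt_or_gt_of_ne hx with hneg | hpos
    · have h1 : x < x' ∧ x' < 0 := by simpa [uIoo, hneg.le, hneg] using hx'
      constructor
      · exact div_pos_of_neg_of_neg h1.2 hneg
      · rw [div_lt_one_of_neg hneg]; exact h1.1
    · have h1 : 0 < x' ∧ x' < x := by simpa [uIoo, hpos.le, hpos] using hx'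
      exact ⟨div_pos h1.1 hpos, (div_lt_one hpos).2 h1.2⟩
  · rw [div_mul_cancel₀ _ hx]; exact h

/-- The chain version of ★: `F 0 (x) = F (k+1) (θx)·x^{k+1}/(k+1)!` with `θ ∈ [0,1]`, for ALL `x` (at `x = 0` both sides vanish when `F 0 0 = 0`). [folklore] -/
theorem exists_lagrange_of_derivChain {F : ℕ → ℝ → ℝ} {k : ℕ} (hd : ∀ j < k + 1, ∀ s, HasDerivAt (F j) (F (j + 1) s) s)
    (hc : Continuous (F (k + 1))) (h0 : ∀ i ≤ k, F i 0 = 0) (x : ℝ) :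
    ∃ θ ∈ Icc (0 : ℝ) 1, F 0 x = F (k + 1) (θ * x) * x ^ (k + 1) / (k + 1)! := by
  have hid := iteratedDeriv_eq_of_derivChain hd
  by_cases hx : x = 0
  · refine ⟨0, ⟨le_rfl, zero_le_one⟩, ?_⟩
    rw [hx, h0 0 (Nat.zero_le k)]; simp
  · obtain ⟨θ, hθ, h⟩ := exists_lagrange_of_jet_vanish (contDiff_of_derivChain hd hc)
      (fun i hi => by rw [hid i (by omega)]; exact h0 i hi) hx
    exact ⟨θ, Ioo_subset_Icc_self hθ, by rwa [hid (k + 1) le_rfl] at h⟩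

/-! ## §2 Two variables with parameters: `G = uᵐ sⁿ Φ`, `Φ` jointly continuous -/

section TwoVar

variable {X : Type*} [TopologicalSpace X] {m n : ℕ} {D : ℕ → ℕ → ℝ × ℝ × X → ℝ}

omit [TopologicalSpace X] in
/-- Vanishing propagates along the grid: (b) `D i 0 (0,s,ξ) = 0` (`i < m`) and the `s`-relations give `D i j (0,s,ξ) = 0` for all `j ≤ n`. [folklore] -/
theorem grid_vanish_u (hs : ∀ i ≤ m, ∀ j < n, ∀ q : ℝ × ℝ × X, HasDerivAt (fun s => D i j (q.1, s, q.2.2)) (D i (j + 1) q) q.2.1)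
    (hb : ∀ i < m, ∀ (s : ℝ) (ξ : X), D i 0 (0, s, ξ) = 0) : ∀ i < m, ∀ j ≤ n, ∀ (s : ℝ) (ξ : X), D i j (0, s, ξ) = 0 := by
  intro i hi j hj
  induction j with
  | zero => exact hb i hi
  | succ j ih =>
    intro s ξ
    have h1 := hs i hi.le j (by omega) (0, s, ξ)
    have hz : (fun s' : ℝ => D i j (0, s', ξ)) = fun _ => 0 := funext fun s' => ih (by omega) s' ξ
    simp only at h1; rw [hz] at h1
    exact h1.unique (hasDerivAt_const s 0)

omit [TopologicalSpace X] in
/-- Symmetrically: (a) `D 0 j (u,0,ξ) = 0` (`j < n`) and the `u`-relations give `D i j (u,0,ξ) = 0` for all `i ≤ m`. [folklore] -/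
theorem grid_vanish_s (hu : ∀ i < m, ∀ j ≤ n, ∀ q : ℝ × ℝ × X, HasDerivAt (fun u => D i j (u, q.2)) (D (i + 1) j q) q.1)
    (ha : ∀ j < n, ∀ (u : ℝ) (ξ : X), D 0 j (u, 0, ξ) = 0) : ∀ j < n, ∀ i ≤ m, ∀ (u : ℝ) (ξ : X), D i j (u, 0, ξ) = 0 := by
  intro j hj i hi
  induction i with
  | zero => exact ha j hj
  | succ i ih =>
    intro u ξ
    have h1 := hu i (by omega) j hj.le (u, 0, ξ)
    have hz : (fun u' : ℝ => D i j (u', ((0 : ℝ), ξ))) = fun _ => 0 := funext fun u' => ih (by omega) u' ξ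
    simp only at h1; rw [hz] at h1
    exact h1.unique (hasDerivAt_const u 0)

/-- Lagrange along the `s`-line at height `i ≤ m`: `D i 0 (u,s,ξ) = D i n (u, θs, ξ)·sⁿ/n!` (`θ ∈ [0,1]`), given `D i j (u,0,ξ) = 0` for `j < n`. [folklore] -/
theorem grid_lagrange_s (hs : ∀ i ≤ m, ∀ j < n, ∀ q : ℝ × ℝ × X, HasDerivAt (fun s => D i j (q.1, s, q.2.2)) (D i (j + 1) q) q.2.1)
    (hc : ∀ i ≤ m, ∀ j ≤ n, Continuous (D i j)) (hn : 0 < n) {i : ℕ} (hi : i ≤ m) (u : ℝ) (ξ : X)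
    (h0 : ∀ j < n, D i j (u, 0, ξ) = 0) (s : ℝ) : ∃ θ ∈ Icc (0 : ℝ) 1, D i 0 (u, s, ξ) = D i n (u, θ * s, ξ) * s ^ n / n ! := by
  obtain ⟨k, rfl⟩ : ∃ k, n = k + 1 := ⟨n - 1, by omega⟩
  have hline : Continuous fun s' : ℝ => ((u, s', ξ) : ℝ × ℝ × X) :=
    continuous_const.prodMk (continuous_id.prodMk continuous_const)
  exact exists_lagrange_of_derivChain (F := fun j s' => D i j (u, s', ξ)) (fun j hj s' => hs i hi j hj (u, s', ξ))
    ((hc i hi (k + 1) le_rfl).comp hline) (fun j hj => h0 j (by omega)) s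

/-- Lagrange along the `u`-line at depth `j ≤ n`: `D 0 j (u,s,ξ) = D m j (θu, s, ξ)·uᵐ/m!` (`θ ∈ [0,1]`), given `D i j (0,s,ξ) = 0` for `i < m`. [folklore] -/
theorem grid_lagrange_u (hu : ∀ i < m, ∀ j ≤ n, ∀ q : ℝ × ℝ × X, HasDerivAt (fun u => D i j (u, q.2)) (D (i + 1) j q) q.1)
    (hc : ∀ i ≤ m, ∀ j ≤ n, Continuous (D i j)) (hm : 0 < m) {j : ℕ} (hj : j ≤ n) (s : ℝ) (ξ : X)
    (h0 : ∀ i < m, D i j (0, s, ξ) = 0) (u : ℝ) : ∃ θ ∈ Icc (0 : ℝ) 1, D 0 j (u, s, ξ) = D m j (θ * u, s, ξ) * u ^ m / m ! := by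
  obtain ⟨k, rfl⟩ : ∃ k, m = k + 1 := ⟨m - 1, by omega⟩
  have hline : Continuous fun u' : ℝ => ((u', s, ξ) : ℝ × ℝ × X) := continuous_id.prodMk continuous_const
  exact exists_lagrange_of_derivChain (F := fun i u' => D i j (u', s, ξ)) (fun i hi u' => hu i hi j hj (u', s, ξ))
    ((hc (k + 1) le_rfl j hj).comp hline) (fun i hi => h0 i (by omega)) u

/-- A bounded factor times a null sequence is null, in the form used for the intermediate points `θ(q)·u`. [folklore] -/
theorem tendsto_mul_of_abs_le_one {α : Type*} {l : Filter α} {θ v : α → ℝ} (hθ : ∀ a, θ a ∈ Icc (0 : ℝ) 1) (hv : Tendsto v l (𝓝 0)) :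
    Tendsto (fun a => θ a * v a) l (𝓝 0) := by
  refine squeeze_zero_norm (fun a => ?_) (tendsto_norm_zero.comp hv)
  simp only [Function.comp_apply, Real.norm_eq_abs, abs_mul]
  exact mul_le_of_le_one_left (abs_nonneg _) (by rw [abs_of_nonneg (hθ a).1]; exact (hθ a).2)

/-- ★★★ **TWO-VARIABLE HADAMARD LEMMA WITH PARAMETERS.**  From the grid `D i j` (`i ≤ m`, `j ≤ n`, `0 < m`, `0 < n`) with both line-derivative relations,
joint continuity, and the vanishing data (a) `D 0 j (u,0,ξ) = 0 (j < n)`, (b) `D i 0 (0,s,ξ) = 0 (i < m)`: there is a JOINTLY CONTINUOUS `Φ` with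
`D 0 0 (u,s,ξ) = uᵐ·sⁿ·Φ(u,s,ξ)` for all `(u,s,ξ)` and `Φ(0,0,ξ) = D m n (0,0,ξ)/(m!·n!)`. [folklore] -/
theorem exists_continuous_twoVarHadamard (hm : 0 < m) (hn : 0 < n)
    (hu : ∀ i < m, ∀ j ≤ n, ∀ q : ℝ × ℝ × X, HasDerivAt (fun u => D i j (u, q.2)) (D (i + 1) j q) q.1)
    (hs : ∀ i ≤ m, ∀ j < n, ∀ q : ℝ × ℝ × X, HasDerivAt (fun s => D i j (q.1, s, q.2.2)) (D i (j + 1) q) q.2.1)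
    (hc : ∀ i ≤ m, ∀ j ≤ n, Continuous (D i j))
    (ha : ∀ j < n, ∀ (u : ℝ) (ξ : X), D 0 j (u, 0, ξ) = 0) (hb : ∀ i < m, ∀ (s : ℝ) (ξ : X), D i 0 (0, s, ξ) = 0) :
    ∃ Φ : ℝ × ℝ × X → ℝ, Continuous Φ ∧ (∀ q, D 0 0 q = q.1 ^ m * q.2.1 ^ n * Φ q) ∧ ∀ ξ, Φ (0, 0, ξ) = D m n (0, 0, ξ) / (m ! * n !) := by
  have hVu := grid_vanish_u hs hb   -- D i j (0,s,ξ) = 0, i < m, j ≤ n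
  have hVs := grid_vanish_s hu ha   -- D i j (u,0,ξ) = 0, j < n, i ≤ m
  -- the piecewise quotient
  set Φ : ℝ × ℝ × X → ℝ := fun q =>
    if q.1 ≠ 0 ∧ q.2.1 ≠ 0 then D 0 0 q / (q.1 ^ m * q.2.1 ^ n)
    else if q.1 ≠ 0 then D 0 n (q.1, 0, q.2.2) / ((n ! : ℝ) * q.1 ^ m)
    else if q.2.1 ≠ 0 then D m 0 (0, q.2.1, q.2.2) / ((m ! : ℝ) * q.2.1 ^ n)
    else D m n (0, 0, q.2.2) / (m ! * n !) with hΦ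
  have hmf : (0 : ℝ) < m ! := by exact_mod_cast Nat.factorial_pos m
  have hnf : (0 : ℝ) < n ! := by exact_mod_cast Nat.factorial_pos n
  -- (R-s): on `{u ≠ 0}`, `Φ q = D 0 n (u, θs, ξ)/(n!·uᵐ)`
  have hRs : ∀ q : ℝ × ℝ × X, q.1 ≠ 0 → ∃ θ ∈ Icc (0 : ℝ) 1, Φ q = D 0 n (q.1, θ * q.2.1, q.2.2) / ((n ! : ℝ) * q.1 ^ m) := by
    rintro ⟨u, s, ξ⟩ hu0
    simp only at hu0
    by_cases hs0 : s = 0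
    · refine ⟨0, ⟨le_rfl, zero_le_one⟩, ?_⟩
      simp only [hΦ, hu0, hs0, ne_eq, not_true_eq_false, and_false, if_false, not_false_eq_true, if_true, mul_zero]
    · obtain ⟨θ, hθ, h⟩ := grid_lagrange_s hs hc hn (Nat.zero_le m) u ξ (fun j hj => hVs j hj 0 (Nat.zero_le m) u ξ) s
      refine ⟨θ, hθ, ?_⟩
      simp only [hΦ, hu0, hs0, ne_eq, not_false_eq_true, and_self, if_true]
      rw [h]; field_simp
  -- (R-u): on `{s ≠ 0}`, `Φ q = D m 0 (θu, s, ξ)/(m!·sⁿ)`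
  have hRu : ∀ q : ℝ × ℝ × X, q.2.1 ≠ 0 → ∃ θ ∈ Icc (0 : ℝ) 1, Φ q = D m 0 (θ * q.1, q.2.1, q.2.2) / ((m ! : ℝ) * q.2.1 ^ n) := by
    rintro ⟨u, s, ξ⟩ hs0
    simp only at hs0
    by_cases hu0 : u = 0
    · refine ⟨0, ⟨le_rfl, zero_le_one⟩, ?_⟩
      simp only [hΦ, hu0, hs0, ne_eq, not_true_eq_false, false_and, if_false, not_false_eq_true, if_true, mul_zero]
    · obtain ⟨θ, hθ, h⟩ := grid_lagrange_u hu hc hm (Nat.zero_le n) s ξ (fun i hi => hVu i hi 0 (Nat.zero_le n) s ξ) u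
      refine ⟨θ, hθ, ?_⟩
      simp only [hΦ, hu0, hs0, ne_eq, not_false_eq_true, and_self, if_true]
      rw [h]; field_simp
  -- (R-0): everywhere, `Φ q = D m n (θ₂u, θ₁s, ξ)/(m!·n!)`
  have hR0 : ∀ q : ℝ × ℝ × X, ∃ θ₁ ∈ Icc (0 : ℝ) 1, ∃ θ₂ ∈ Icc (0 : ℝ) 1, Φ q = D m n (θ₂ * q.1, θ₁ * q.2.1, q.2.2) / (m ! * n !) := by
    rintro ⟨u, s, ξ⟩
    by_cases hu0 : u = 0
    · by_cases hs0 : s = 0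
      · refine ⟨0, ⟨le_rfl, zero_le_one⟩, 0, ⟨le_rfl, zero_le_one⟩, ?_⟩
        simp only [hΦ, hu0, hs0, ne_eq, not_true_eq_false, and_self, if_false, mul_zero]
      · -- `Φ = D m 0 (0,s,ξ)/(m! sⁿ)` and the `s`-line Lagrange at height `m` from `D m j (0,0,ξ) = 0 (j<n)`
        obtain ⟨θ, hθ, hq⟩ := hRu (u, s, ξ) hs0
        obtain ⟨θ₁, hθ₁, h⟩ := grid_lagrange_s hs hc hn le_rfl 0 ξ (fun j hj => hVs j hj m le_rfl 0 ξ) s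
        refine ⟨θ₁, hθ₁, 0, ⟨le_rfl, zero_le_one⟩, ?_⟩
        rw [hq]; simp only [hu0, mul_zero]
        rw [h]; field_simp
    · by_cases hs0 : s = 0
      · obtain ⟨θ, hθ, hq⟩ := hRs (u, s, ξ) hu0
        obtain ⟨θ₂, hθ₂, h⟩ := grid_lagrange_u hu hc hm le_rfl 0 ξ (fun i hi => hVu i hi n le_rfl 0 ξ) u
        refine ⟨0, ⟨le_rfl, zero_le_one⟩, θ₂, hθ₂, ?_⟩
        rw [hq]; simp only [hs0, mul_zero]
        rw [h]; field_simp
      · obtain ⟨θ₁, hθ₁, h1⟩ := grid_lagrange_s hs hc hn (Nat.zero_le m) u ξ (fun j hj => hVs j hj 0 (Nat.zero_le m) u ξ) s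
        obtain ⟨θ₂, hθ₂, h2⟩ := grid_lagrange_u hu hc hm le_rfl (θ₁ * s) ξ (fun i hi => hVu i hi n le_rfl (θ₁ * s) ξ) u
        refine ⟨θ₁, hθ₁, θ₂, hθ₂, ?_⟩
        have hq : Φ (u, s, ξ) = D 0 0 (u, s, ξ) / (u ^ m * s ^ n) := by
          simp only [hΦ, hu0, hs0, ne_eq, not_false_eq_true, and_self, if_true]
        rw [hq, h1, h2]; field_simp
  refine ⟨Φ, ?_, ?_, fun ξ => by simp only [hΦ, ne_eq, not_true_eq_false, and_self, if_false]⟩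
  · -- joint continuity, pointwise by strata of the base point
    refine continuous_iff_continuousAt.2 ?_
    rintro ⟨u₀, s₀, ξ₀⟩
    have hξ : Tendsto (fun q : ℝ × ℝ × X => q.2.2) (𝓝 (u₀, s₀, ξ₀)) (𝓝 ξ₀) := continuous_snd.snd.continuousAt
    have hu' : Tendsto (fun q : ℝ × ℝ × X => q.1) (𝓝 (u₀, s₀, ξ₀)) (𝓝 u₀) := continuous_fst.continuousAt
    have hs' : Tendsto (fun q : ℝ × ℝ × X => q.2.1) (𝓝 (u₀, s₀, ξ₀)) (𝓝 s₀) := continuous_snd.fst.continuousAt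
    by_cases hu0 : u₀ = 0
    · by_cases hs0 : s₀ = 0
      · -- base point `(0,0,ξ₀)`: use (R-0)
        subst hu0; subst hs0
        choose θ₁ hθ₁ θ₂ hθ₂ hrep using hR0
        have hinner : Tendsto (fun q : ℝ × ℝ × X => ((θ₂ q * q.1, θ₁ q * q.2.1, q.2.2) : ℝ × ℝ × X)) (𝓝 (0, 0, ξ₀)) (𝓝 (0, 0, ξ₀)) :=
          (tendsto_mul_of_abs_le_one hθ₂ hu').prodMk_nhds ((tendsto_mul_of_abs_le_one hθ₁ hs').prodMk_nhds hξ)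
        have := ((hc m le_rfl n le_rfl).continuousAt.tendsto.comp hinner).div_const ((m ! : ℝ) * n !)
        refine (this.congr fun q => (hrep q).symm).congr' ?_ |>.mono_right ?_
        · exact Eventually.of_forall fun _ => rfl
        · rw [hrep (0, 0, ξ₀)]; simp
      · -- base point `(0,s₀,ξ₀)`, `s₀ ≠ 0`: use (R-u) on the open set `{s ≠ 0}`
        subst hu0
        have hθ : ∀ q : ℝ × ℝ × X, ∃ θ ∈ Icc (0 : ℝ) 1, q.2.1 ≠ 0 → Φ q = D m 0 (θ * q.1, q.2.1, q.2.2) / ((m ! : ℝ) * q.2.1 ^ n) := by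
          intro q
          by_cases h : q.2.1 ≠ 0
          · obtain ⟨θ, hθ, e⟩ := hRu q h; exact ⟨θ, hθ, fun _ => e⟩
          · exact ⟨0, ⟨le_rfl, zero_le_one⟩, fun h' => absurd h' h⟩
        choose θ hθ hrep using hθ
        have hinner : Tendsto (fun q : ℝ × ℝ × X => ((θ q * q.1, q.2.1, q.2.2) : ℝ × ℝ × X)) (𝓝 (0, s₀, ξ₀)) (𝓝 (0, s₀, ξ₀)) :=
          (tendsto_mul_of_abs_le_one hθ hu').prodMk_nhds (hs'.prodMk_nhds hξ)
        have hlim := ((hc m le_rfl 0 (Nat.zero_le n)).continuousAt.tendsto.comp hinner).div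
          ((hs'.pow n).const_mul (m ! : ℝ)) (by positivity)
        have hev : ∀ᶠ q : ℝ × ℝ × X in 𝓝 (0, s₀, ξ₀), q.2.1 ≠ 0 := hs'.eventually (isOpen_ne.mem_nhds hs0)
        refine (hlim.congr' (hev.mono fun q hq => (hrep q hq).symm)).mono_right (le_of_eq ?_)
        rw [hrep (0, s₀, ξ₀) hs0]; simp
    · by_cases hs0 : s₀ = 0
      · -- base point `(u₀,0,ξ₀)`, `u₀ ≠ 0`: use (R-s) on the open set `{u ≠ 0}`
        subst hs0
        have hθ : ∀ q : ℝ × ℝ × X, ∃ θ ∈ Icc (0 : ℝ) 1, q.1 ≠ 0 → Φ q = D 0 n (q.1, θ * q.2.1, q.2.2) / ((n ! : ℝ) * q.1 ^ m) := by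
          intro q
          by_cases h : q.1 ≠ 0
          · obtain ⟨θ, hθ, e⟩ := hRs q h; exact ⟨θ, hθ, fun _ => e⟩
          · exact ⟨0, ⟨le_rfl, zero_le_one⟩, fun h' => absurd h' h⟩
        choose θ hθ hrep using hθ
        have hinner : Tendsto (fun q : ℝ × ℝ × X => ((q.1, θ q * q.2.1, q.2.2) : ℝ × ℝ × X)) (𝓝 (u₀, 0, ξ₀)) (𝓝 (u₀, 0, ξ₀)) :=
          hu'.prodMk_nhds ((tendsto_mul_of_abs_le_one hθ hs').prodMk_nhds hξ)
        have hlim := ((hc 0 (Nat.zero_le m) n le_rfl).continuousAt.tendsto.comp hinner).div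
          ((hu'.pow m).const_mul (n ! : ℝ)) (by positivity)
        have hev : ∀ᶠ q : ℝ × ℝ × X in 𝓝 (u₀, 0, ξ₀), q.1 ≠ 0 := hu'.eventually (isOpen_ne.mem_nhds hu0)
        refine (hlim.congr' (hev.mono fun q hq => (hrep q hq).symm)).mono_right (le_of_eq ?_)
        rw [hrep (u₀, 0, ξ₀) hu0]; simp
      · -- generic base point: `Φ = D 0 0/(uᵐ sⁿ)` near it
        have hlim := ((hc 0 (Nat.zero_le m) 0 (Nat.zero_le n)).continuousAt (x := (u₀, s₀, ξ₀))).tendsto.div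
          ((hu'.pow m).mul (hs'.pow n)) (by positivity)
        have hev : ∀ᶠ q : ℝ × ℝ × X in 𝓝 (u₀, s₀, ξ₀), q.1 ≠ 0 ∧ q.2.1 ≠ 0 :=
          (hu'.eventually (isOpen_ne.mem_nhds hu0)).and (hs'.eventually (isOpen_ne.mem_nhds hs0))
        have hrep : ∀ q : ℝ × ℝ × X, q.1 ≠ 0 ∧ q.2.1 ≠ 0 → Φ q = D 0 0 q / (q.1 ^ m * q.2.1 ^ n) := fun q hq => by
          simp only [hΦ, hq, ne_eq, not_false_eq_true, and_self, if_true]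
        refine (hlim.congr' (hev.mono fun q hq => (hrep q hq).symm)).mono_right (le_of_eq ?_)
        rw [hrep (u₀, s₀, ξ₀) ⟨hu0, hs0⟩]
  · -- the identity `D 0 0 = uᵐ sⁿ Φ`
    rintro ⟨u, s, ξ⟩
    by_cases hu0 : u = 0
    · rw [hu0, hVu 0 hm 0 (Nat.zero_le n) s ξ]; simp [zero_pow hm.ne']
    · by_cases hs0 : s = 0
      · rw [hs0, hVs 0 hn 0 (Nat.zero_le m) u ξ]; simp [zero_pow hn.ne']
      · have : Φ (u, s, ξ) = D 0 0 (u, s, ξ) / (u ^ m * s ^ n) := by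
          simp only [hΦ, hu0, hs0, ne_eq, not_false_eq_true, and_self, if_true]
        rw [this]; field_simp

end TwoVar

end Summit.QuantumFields.YangMills.Theorems.SwapVirialDeficit.BlowUp

end
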